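import Literature.Probability.RandomPlanarGeometry.HexSAWStripSurfaceGrowthWidthOne
import Literature.Probability.RandomPlanarGeometry.HexSAWStripSurfaceWidthOneThreshold
import HarnessLib

/-!
# The chain partition function of the width-ONE strip exactly, and the parity obstruction at its threshold:
# `x_c^{2k} Z_{1,2k}(y₁) = 6 + 2√2` but `x_c^{2k+1} Z_{1,2k+1}(y₁) = 4x_c(2 + √2)` — the sequence `x_c^n Z_{1,n}(y₁)` does NOT converge
# (module «CHAIN-PARITY-WIDTH-ONE»)

Topic `Literature/Probability/RandomPlanarGeometry` (continues `HexSAWStripSurfaceGrowthWidthOne.lean` — `HV.card_stripChains_one_le` (at most four chains of each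
length), `HV.stripNu_one_eq_sqrt` —, `HexSAWStripWidthOne.lean` (the path model `HV.vtx p`, `pos1`, `adj_vtx_succ/pred`, `bit_vtx`, `vtx_snd`, `vtx_fst`),
`HexSAWStripSurfaceWidthOneThreshold.lean` (`HV.hexCriticalFugacity_sq_mul_stripYT_one : x_c² y₁ = 1`), `HexSAWStripSurfaceGrowth.lean` (`HV.stripChains`, `HV.stripZL`)).
Lane «pcv-sawmu», a-p2 g22 — car 11: the width-one case of the CHAIN analogue of the β-walk length law (#586 / «WIDTH-ONE»), showing that the
statement «NOT claimed: convergence of x_c^n Z_{T,n}(y_T)» of `HexSAWStripThresholdChainPointwise.lean` is sharp — the even and odd subsequences have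
different limits.  Sources of the SETTING: N. R. Beaton et al., CMP 326 (2014) proof of Proposition 5 and of Corollary 8 (arXiv v5 pp. 9, 12: zig-zag
paths; `ρ_T(y) ≤ 1/√y`); N. Madras, G. Slade (1993) §8.2 (walks in a tube up to translation).  The numbers are the lane's.

## What is proved (namespace `Literature.Probability.RandomPlanarGeometry.SAW.HV`)

* `zigChain p₀ s n` (the path run `vtx(p₀ + s i)`, `i = 0..n`), `zigChain_mem` (a chain of `S_1` for `p₀ ∈ {0,1}`, `s = ±1`), `stripChains_one_eq`
  (for `n ≥ 1` the four runs ARE `stripChains 1 n`), `topCnt_zigChain` (the odd positions);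
* ★ `stripZL_one_eq` — **`Z_{1,n}(y) = 2y^{⌊(n+1)/2⌋} + 2y^{⌊n/2⌋+1}`** for `n ≥ 1`;
* ★★ `pow_mul_stripZL_one_even` / `pow_mul_stripZL_one_odd` — `x_c^{2k} Z_{1,2k}(y₁) = 6 + 2√2` (`k ≥ 1`) and `x_c^{2k+1} Z_{1,2k+1}(y₁) = 4x_c(2 + √2)`;
  ★★ `not_tendsto_pow_mul_stripZL_one` — `x_c^n Z_{1,n}(y₁)` has no limit (the two constants differ: `(6 + 2√2)² = 44 + 24√2 ≠ 32 + 16√2 = (4x_c(2+√2))²`).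

Label: LANE THEOREM (S, own, a-p2 g22, 2026-08-26).  NOT claimed: widths `T ≥ 2` (there the even/odd limits are expected to exist and differ, but this needs a
renewal split for chains).
-/

noncomputable section

open Finset Filter Topology

namespace Literature.Probability.RandomPlanarGeometry.SAW.HV

/-! ### §1 The four chains of the width-one strip -/

/-- The run of the width-one path from position `p₀` in direction `s` with `n + 1` vertices: `vtx(p₀ + s·i)`, `i = 0, …, n` (plumbing).
[cite: BeatonBousquetMelouDeGierDuminilCopinGuttmann2014, proof of Proposition 5 (arXiv v5 p. 9: zig-zag paths); lane plumbing] -/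
def zigChain (p₀ s : ℤ) (n : ℕ) : List HV := (List.range (n + 1)).map fun i : ℕ => vtx (p₀ + s * (i : ℤ))

/-- Length and entries of `zigChain` (plumbing). [cite: DuminilCopinSmirnov2012, §3; lane plumbing] -/
theorem zigChain_basic (p₀ s : ℤ) (n : ℕ) :
    (zigChain p₀ s n).length = n + 1 ∧ ∀ (i : ℕ) (hi : i < (zigChain p₀ s n).length), (zigChain p₀ s n)[i] = vtx (p₀ + s * (i : ℤ)) := by
  refine ⟨by simp [zigChain], fun i hi => by simp [zigChain]⟩

/-- ★ `zigChain p₀ s n ∈ stripChains 1 n` for `p₀ ∈ {0, 1}`, `s = ±1`. [cite: MadrasSlade1993, §8.2 eq. (8.2.1); BeatonBousquetMelouDeGierDuminilCopinGuttmann2014, proof of Proposition 5; lane «pcv-sawmu» a-p2 g22] -/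
theorem zigChain_mem {p₀ s : ℤ} (hp : p₀ = 0 ∨ p₀ = 1) (hs : s = 1 ∨ s = -1) (n : ℕ) : zigChain p₀ s n ∈ stripChains 1 n := by
  obtain ⟨hlen, hget⟩ := zigChain_basic p₀ s n
  have hs0 : s ≠ 0 := by rcases hs with rfl | rfl <;> norm_num
  rw [mem_stripChains_iff]
  refine ⟨?_, ?_, hlen, ⟨vtx p₀, ?_, ?_⟩, ?_⟩
  · rw [List.isChain_iff_getElem]
    intro i hi
    rw [hget, hget]
    push_cast
    rcases hs with rfl | rfl
    · rw [one_mul, one_mul, show p₀ + ((i : ℤ) + 1) = p₀ + i + 1 by ring]; exact adj_vtx_succ _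
    · rw [neg_one_mul, neg_one_mul, show p₀ + -((i : ℤ) + 1) = p₀ + -(i : ℤ) - 1 by ring]; exact adj_vtx_pred _
  · refine (List.nodup_range).map fun i j hij => ?_
    have := congrArg pos1 hij
    simp only [pos1_vtx] at this
    exact_mod_cast mul_left_cancel₀ hs0 (by linarith : s * (i : ℤ) = s * (j : ℤ))
  · rw [zigChain, List.range_succ_eq_map, List.map_cons]; simp
  · rw [vtx_fst]; rcases hp with rfl | rfl <;> norm_num
  · intro v hv
    rw [zigChain, List.mem_map] at hv
    obtain ⟨i, -, rfl⟩ := hv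
    simp only [lev, vtx_snd, bit_vtx, mul_zero, zero_add, Nat.cast_one]
    omega

/-- The four runs are pairwise distinct for `n ≥ 1` (plumbing). [cite: DuminilCopinSmirnov2012, §3; lane plumbing] -/
theorem zigChain_injective {n : ℕ} (hn : 1 ≤ n) {p₀ p₀' s s' : ℤ} (h : zigChain p₀ s n = zigChain p₀' s' n) : p₀ = p₀' ∧ s = s' := by
  obtain ⟨hlen, hget⟩ := zigChain_basic p₀ s n
  obtain ⟨hlen', hget'⟩ := zigChain_basic p₀' s' n
  have h0 : (zigChain p₀ s n)[0]'(by omega) = (zigChain p₀' s' n)[0]'(by omega) := by simp only [h]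
  have h1 : (zigChain p₀ s n)[1]'(by omega) = (zigChain p₀' s' n)[1]'(by omega) := by simp only [h]
  rw [hget, hget'] at h0 h1
  have e0 := congrArg pos1 h0
  have e1 := congrArg pos1 h1
  simp only [pos1_vtx] at e0 e1
  push_cast at e0 e1
  constructor <;> linarith

/-- ★ **For `n ≥ 1` the chains of `S_1` are exactly the four runs** (two standard heads `vtx 0`, `vtx 1` × two directions).
[cite: MadrasSlade1993, §8.2; BeatonBousquetMelouDeGierDuminilCopinGuttmann2014, proof of Proposition 5; lane «pcv-sawmu» a-p2 g22] -/
theorem stripChains_one_eq {n : ℕ} (hn : 1 ≤ n) :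
    stripChains 1 n = {zigChain 0 1 n, zigChain 0 (-1) n, zigChain 1 1 n, zigChain 1 (-1) n} := by
  classical
  symm
  apply Finset.eq_of_subset_of_card_le
  · intro l hl
    simp only [Finset.mem_insert, Finset.mem_singleton] at hl
    rcases hl with rfl | rfl | rfl | rfl
    · exact zigChain_mem (Or.inl rfl) (Or.inl rfl) n
    · exact zigChain_mem (Or.inl rfl) (Or.inr rfl) n
    · exact zigChain_mem (Or.inr rfl) (Or.inl rfl) n
    · exact zigChain_mem (Or.inr rfl) (Or.inr rfl) n
  · refine (card_stripChains_one_le n).trans ?_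
    have d1 : zigChain 0 1 n ≠ zigChain 0 (-1) n := fun h => by have := (zigChain_injective hn h).2; norm_num at this
    have d2 : zigChain 0 1 n ≠ zigChain 1 1 n := fun h => by have := (zigChain_injective hn h).1; norm_num at this
    have d3 : zigChain 0 1 n ≠ zigChain 1 (-1) n := fun h => by have := (zigChain_injective hn h).1; norm_num at this
    have d4 : zigChain 0 (-1) n ≠ zigChain 1 1 n := fun h => by have := (zigChain_injective hn h).1; norm_num at this
    have d5 : zigChain 0 (-1) n ≠ zigChain 1 (-1) n := fun h => by have := (zigChain_injective hn h).1; norm_num at this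
    have d6 : zigChain 1 1 n ≠ zigChain 1 (-1) n := fun h => by have := (zigChain_injective hn h).2; norm_num at this
    rw [card_insert_of_notMem (by simp [d1, d2, d3]), card_insert_of_notMem (by simp [d4, d5]), card_insert_of_notMem (by simp [d6]),
      card_singleton]

/-! ### §2 The contacts of a run: the odd positions -/

/-- Counting parities in `range N` (plumbing): `#{i < N : i odd} = N/2`, `#{i < N : i even} = (N+1)/2`. [folklore] -/
private theorem length_filter_parity_range (N : ℕ) :
    ((List.range N).filter (fun i => i % 2 = 1)).length = N / 2 ∧ ((List.range N).filter (fun i => i % 2 = 0)).length = (N + 1) / 2 := by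
  induction N with
  | zero => simp
  | succ N ih =>
    rw [List.range_succ, List.filter_append, List.filter_append, List.length_append, List.length_append, ih.1, ih.2]
    rcases Nat.even_or_odd N with ⟨k, hk⟩ | ⟨k, hk⟩
    · simp only [List.filter_singleton, show N % 2 = 0 by omega, decide_true]
      simp; omega
    · simp only [List.filter_singleton, show N % 2 = 1 by omega, decide_true]
      simp; omega

/-- ★ The run from `vtx p₀` (`p₀ ∈ {0,1}`, `s = ±1`) with `n + 1` vertices has `(n+1)/2` top contacts if `p₀ = 0` and `n/2 + 1` if `p₀ = 1` (contacts =
vertices at odd positions of the path). [cite: BeatonBousquetMelouDeGierDuminilCopinGuttmann2014, proof of Proposition 5 (arXiv v5 p. 9); lane «pcv-sawmu» a-p2 g22] -/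
theorem topCnt_zigChain {p₀ s : ℤ} (hp : p₀ = 0 ∨ p₀ = 1) (hs : s = 1 ∨ s = -1) (n : ℕ) :
    topCnt 1 (zigChain p₀ s n) = if p₀ = 0 then (n + 1) / 2 else n / 2 + 1 := by
  obtain ⟨hodd, heven⟩ := length_filter_parity_range (n + 1)
  rw [topCnt, zigChain, List.filter_map, List.length_map]
  have key : ∀ i : ℕ, (decide (lev (vtx (p₀ + s * (i : ℤ))) = 2 * ((1 : ℕ) : ℤ) - 1)) =
      decide (if p₀ = 0 then i % 2 = 1 else i % 2 = 0) := by
    intro i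
    simp only [lev, vtx_snd, bit_vtx, mul_zero, zero_add, Nat.cast_one]
    rcases hp with rfl | rfl <;> rcases hs with rfl | rfl <;> simp <;> omega
  have hcongr : (List.range (n + 1)).filter ((fun v => decide (lev v = 2 * ((1 : ℕ) : ℤ) - 1)) ∘ fun i : ℕ => vtx (p₀ + s * (i : ℤ))) =
      (List.range (n + 1)).filter (fun i => decide (if p₀ = 0 then i % 2 = 1 else i % 2 = 0)) :=
    List.filter_congr fun i _ => key i
  rw [hcongr]
  rcases hp with rfl | rfl
  · simp only [if_true]; convert hodd using 3
  · simp only [show ¬ ((1 : ℤ) = 0) by norm_num, if_false]; convert heven using 3; omega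

/-! ### §3 `Z_{1,n}(y)` exactly and the parity obstruction at `y₁` -/

/-- ★ **`Z_{1,n}(y) = 2y^{⌊(n+1)/2⌋} + 2y^{⌊n/2⌋+1}` for `n ≥ 1`** (two directions from the level-`0` head, two from the level-`1` head).
[cite: BeatonBousquetMelouDeGierDuminilCopinGuttmann2014, proof of Corollary 8 (arXiv v5 p. 12: ρ_T(y) ≤ 1/√y by counting zig-zag paths); lane «pcv-sawmu» a-p2 g22 — own] -/
theorem stripZL_one_eq {n : ℕ} (hn : 1 ≤ n) (y : ℝ) : stripZL 1 n y = 2 * y ^ ((n + 1) / 2) + 2 * y ^ (n / 2 + 1) := by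
  classical
  have d1 : zigChain 0 1 n ≠ zigChain 0 (-1) n := fun h => by have := (zigChain_injective hn h).2; norm_num at this
  have d2 : zigChain 0 1 n ≠ zigChain 1 1 n := fun h => by have := (zigChain_injective hn h).1; norm_num at this
  have d3 : zigChain 0 1 n ≠ zigChain 1 (-1) n := fun h => by have := (zigChain_injective hn h).1; norm_num at this
  have d4 : zigChain 0 (-1) n ≠ zigChain 1 1 n := fun h => by have := (zigChain_injective hn h).1; norm_num at this
  have d5 : zigChain 0 (-1) n ≠ zigChain 1 (-1) n := fun h => by have := (zigChain_injective hn h).1; norm_num at this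
  have d6 : zigChain 1 1 n ≠ zigChain 1 (-1) n := fun h => by have := (zigChain_injective hn h).2; norm_num at this
  rw [stripZL, stripChains_one_eq hn, sum_insert (by simp [d1, d2, d3]), sum_insert (by simp [d4, d5]), sum_insert (by simp [d6]), sum_singleton,
    topCnt_zigChain (Or.inl rfl) (Or.inl rfl), topCnt_zigChain (Or.inl rfl) (Or.inr rfl), topCnt_zigChain (Or.inr rfl) (Or.inl rfl),
    topCnt_zigChain (Or.inr rfl) (Or.inr rfl)]
  simp only [if_true, show ¬ ((1 : ℤ) = 0) by norm_num, if_false]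
  ring

/-- ★★ **Even lengths at the threshold**: `x_c^{2k} Z_{1,2k}(y₁) = 2 + 2y₁ = 6 + 2√2` for `k ≥ 1` (`y₁ = 2 + √2`, `x_c² y₁ = 1`).
[cite: BeatonBousquetMelouDeGierDuminilCopinGuttmann2014, Corollary 8 (arXiv v5 p. 12); lane «pcv-sawmu» a-p2 g22 — own] -/
theorem pow_mul_stripZL_one_even {k : ℕ} (hk : 1 ≤ k) : hexCriticalFugacity ^ (2 * k) * stripZL 1 (2 * k) (stripYT 1) = 6 + 2 * Real.sqrt 2 := by
  have h1 := hexCriticalFugacity_sq_mul_stripYT_one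
  rw [stripZL_one_eq (by omega), show (2 * k + 1) / 2 = k by omega, show 2 * k / 2 + 1 = k + 1 by omega, stripYT_one]
  rw [stripYT_one] at h1
  have hp : hexCriticalFugacity ^ (2 * k) * (2 + Real.sqrt 2) ^ k = 1 := by
    rw [pow_mul, ← mul_pow, h1, one_pow]
  calc hexCriticalFugacity ^ (2 * k) * (2 * (2 + Real.sqrt 2) ^ k + 2 * (2 + Real.sqrt 2) ^ (k + 1))
      = (hexCriticalFugacity ^ (2 * k) * (2 + Real.sqrt 2) ^ k) * (2 + 2 * (2 + Real.sqrt 2)) := by ring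
    _ = 6 + 2 * Real.sqrt 2 := by rw [hp]; ring

/-- ★★ **Odd lengths at the threshold**: `x_c^{2k+1} Z_{1,2k+1}(y₁) = 4x_c y₁ = 4x_c(2 + √2)` for every `k`.
[cite: BeatonBousquetMelouDeGierDuminilCopinGuttmann2014, Corollary 8 (arXiv v5 p. 12); lane «pcv-sawmu» a-p2 g22 — own] -/
theorem pow_mul_stripZL_one_odd (k : ℕ) :
    hexCriticalFugacity ^ (2 * k + 1) * stripZL 1 (2 * k + 1) (stripYT 1) = 4 * hexCriticalFugacity * (2 + Real.sqrt 2) := by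
  have h1 := hexCriticalFugacity_sq_mul_stripYT_one
  rw [stripZL_one_eq (by omega), show (2 * k + 1 + 1) / 2 = k + 1 by omega, show (2 * k + 1) / 2 + 1 = k + 1 by omega, stripYT_one]
  rw [stripYT_one] at h1
  have hp : hexCriticalFugacity ^ (2 * k) * (2 + Real.sqrt 2) ^ k = 1 := by
    rw [pow_mul, ← mul_pow, h1, one_pow]
  calc hexCriticalFugacity ^ (2 * k + 1) * (2 * (2 + Real.sqrt 2) ^ (k + 1) + 2 * (2 + Real.sqrt 2) ^ (k + 1))
      = (hexCriticalFugacity ^ (2 * k) * (2 + Real.sqrt 2) ^ k) * (4 * hexCriticalFugacity * (2 + Real.sqrt 2)) := by ring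
    _ = 4 * hexCriticalFugacity * (2 + Real.sqrt 2) := by rw [hp, one_mul]

/-- The two constants differ: `6 + 2√2 ≠ 4x_c(2 + √2)` (squares `44 + 24√2` vs `16(2 + √2)`). [cite: DuminilCopinSmirnov2012, Theorem 1 (x_c = 1/√(2+√2)); lane plumbing] -/
theorem chainParity_constants_ne : (6 + 2 * Real.sqrt 2 : ℝ) ≠ 4 * hexCriticalFugacity * (2 + Real.sqrt 2) := by
  intro h
  have hr : Real.sqrt 2 ^ 2 = 2 := Real.sq_sqrt (by norm_num)
  have h1 := hexCriticalFugacity_sq_mul_stripYT_one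
  rw [stripYT_one] at h1
  have hsq : (6 + 2 * Real.sqrt 2) ^ 2 = 16 * (hexCriticalFugacity ^ 2 * (2 + Real.sqrt 2)) * (2 + Real.sqrt 2) := by rw [h]; ring
  rw [h1] at hsq
  nlinarith [Real.sqrt_nonneg 2, hr]

/-- ★★ **THE PARITY OBSTRUCTION**: the sequence `x_c^n Z_{1,n}(y₁)` does NOT converge — its even subsequence is constantly `6 + 2√2`, its odd subsequence
constantly `4x_c(2 + √2)`.  (At `T = 1` the chain analogue of the β-walk length law #586 fails without parity splitting; for the β-walks themselves odd
lengths are empty and the even ones converge, «WIDTH-ONE».) [cite: BeatonBousquetMelouDeGierDuminilCopinGuttmann2014, Corollary 8; MadrasSlade1993, §8.2; lane «pcv-sawmu» a-p2 g22 — own] -/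
theorem not_tendsto_pow_mul_stripZL_one (c : ℝ) : ¬ Tendsto (fun n : ℕ => hexCriticalFugacity ^ n * stripZL 1 n (stripYT 1)) atTop (𝓝 c) := by
  intro h
  have h2N : Tendsto (fun k : ℕ => 2 * k) atTop atTop := tendsto_atTop_atTop.2 fun n => ⟨n, fun m hm => by omega⟩
  have h2N1 : Tendsto (fun k : ℕ => 2 * k + 1) atTop atTop := tendsto_atTop_atTop.2 fun n => ⟨n, fun m hm => by omega⟩
  have he : Tendsto (fun k : ℕ => hexCriticalFugacity ^ (2 * k) * stripZL 1 (2 * k) (stripYT 1)) atTop (𝓝 (6 + 2 * Real.sqrt 2)) :=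
    tendsto_const_nhds.congr' ((eventually_ge_atTop 1).mono fun k hk => (pow_mul_stripZL_one_even hk).symm)
  have ho : Tendsto (fun k : ℕ => hexCriticalFugacity ^ (2 * k + 1) * stripZL 1 (2 * k + 1) (stripYT 1)) atTop (𝓝 (4 * hexCriticalFugacity * (2 + Real.sqrt 2))) :=
    tendsto_const_nhds.congr' (Eventually.of_forall fun k => (pow_mul_stripZL_one_odd k).symm)
  have hc1 : c = 6 + 2 * Real.sqrt 2 := tendsto_nhds_unique (h.comp h2N) he
  have hc2 : c = 4 * hexCriticalFugacity * (2 + Real.sqrt 2) := tendsto_nhds_unique (h.comp h2N1) ho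
  exact chainParity_constants_ne (hc1.symm.trans hc2)

end Literature.Probability.RandomPlanarGeometry.SAW.HV
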